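import Literature.Probability.Percolation.OneArmRenewal
import HarnessLib

/-!
# Differences of averaged distribution functions: the last display of LSW's Lemma 2.3 (proofs only)

Topic `Probability/Percolation`; theorems only, a sequel of `OneArmHittingPDE` (`tildeAvg`) and
`OneArmRenewal` (`dataU`). In the proof of Lemma 2.3 of Lawler–Schramm–Werner, *One-arm exponent
for critical 2D percolation*, Electron. J. Probab. **7** (2002), paper no. 2 (p. 7), the Neumann
estimate is concluded from a bound on the conformal radii by

> "Hence, `h̃(2π, t) - h̃(θ, t) ≤ ∫₀¹ P[log 𝔯(θ) - log 𝔯(2π) ≥ s] ds = o(ε)`",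

where `h(θ, t) = P[𝔯(θ) ≤ e^{-t}]`, `h̃(θ, t) = ∫₀¹ h(θ, t + s) ds` and `𝔯(2π) ≤ 𝔯(θ)` (the
sets `Q(θ) ⊆ Q(2π)` increase with the arc). This file proves that step for two arbitrary random
variables `0 < X₂ ≤ X₁` on a probability space, with distribution functions
`uᵢ(s) = P[Xᵢ ≤ e^{-s}]`, in the three forms in which the tree consumes the hitting function:

* `intervalIntegral_measureReal_sub_le` — `∫_a^{a+1} (u₂ - u₁) ≤ E[min{log X₁ - log X₂, 1}]`
  (Fubini: `u₂(s) - u₁(s) = P[-log X₁ < s ≤ -log X₂]`, and the Lebesgue measure of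
  `[a, a + 1] ∩ (-log X₁, -log X₂]` is at most `min{log X₁ - log X₂, 1}`); LSW's display is the
  equality `E[min{Z, 1}] = ∫₀¹ P[Z ≥ s] ds`, `Z = log X₁ - log X₂ ≥ 0`, read backwards;
* `tildeAvg_sub_tildeAvg_le` — the same for LSW's `h̃`: `0 ≤ avg u₂ (t) - avg u₁ (t) ≤ E[min{…, 1}]`;
* `dataU_sub_dataU_le` — and for the twice-averaged data `dataU = avg ∘ avg` of the renewal line
  (`OneArmRenewal`, `OneArmComparisonOneSided`): `0 ≤ dataU u₂ t - dataU u₁ t ≤ E[min{…, 1}]`.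

With `X₁ = 𝔯(θ)`, `X₂ = 𝔯(2π)` this turns an estimate `E[min{log 𝔯(θ) - log 𝔯(2π), 1}] = o(2π - θ)`
(LSW's (2.14)–(2.16)) into the Dini/Neumann condition at `2π` for the data of
`LawlerSchrammWerner2002_scalingLimitExponent_of_le_of_dini`. No new definitions, no named facts.

## References

* G. F. Lawler, O. Schramm, W. Werner, *One-arm exponent for critical 2D percolation*, Electron.
  J. Probab. 7 (2002), no. 2, proof of Lemma 2.3 (p. 7, last display) [LawlerSchrammWernerEJP2002].

## Mathlib / tree

Mathlib: `integral_integral_swap` (Fubini), `integral_indicator_one`, `measureReal_sdiff`,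
`Real.volume_real_Ioc`. Tree: `tildeAvg`, `tildeAvg_eq_integral`, `dataU`.
-/

noncomputable section

open MeasureTheory Filter Topology Set
open scoped NNReal

namespace Literature.Probability.Percolation

section Bridge

variable {Ω : Type*} [MeasurableSpace Ω] (P : Measure Ω) [IsProbabilityMeasure P] {X₁ X₂ : Ω → ℝ}

/-- `P[X₂ ≤ e^{-s}] - P[X₁ ≤ e^{-s}] = P[X₂ ≤ e^{-s} < X₁]` for `X₂ ≤ X₁`. [folklore] -/
theorem measureReal_le_exp_neg_sub_eq (hX₁ : Measurable X₁) (hle : ∀ ω, X₂ ω ≤ X₁ ω) (s : ℝ) :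
    P.real {ω | X₂ ω ≤ Real.exp (-s)} - P.real {ω | X₁ ω ≤ Real.exp (-s)} =
      P.real {ω | X₂ ω ≤ Real.exp (-s) ∧ Real.exp (-s) < X₁ ω} := by
  have hsub : {ω | X₁ ω ≤ Real.exp (-s)} ⊆ {ω | X₂ ω ≤ Real.exp (-s)} :=
    fun ω hω ↦ (hle ω).trans hω
  have hmeas : MeasurableSet {ω | X₁ ω ≤ Real.exp (-s)} := measurableSet_le hX₁ measurable_const
  rw [← measureReal_sdiff hsub hmeas]
  congr 1
  ext ω
  simp only [Set.mem_sdiff, mem_setOf_eq, not_le]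

/-- The distribution functions are ordered: `P[X₁ ≤ e^{-s}] ≤ P[X₂ ≤ e^{-s}]`. [folklore] -/
theorem measureReal_le_exp_neg_mono (hle : ∀ ω, X₂ ω ≤ X₁ ω) (s : ℝ) :
    P.real {ω | X₁ ω ≤ Real.exp (-s)} ≤ P.real {ω | X₂ ω ≤ Real.exp (-s)} :=
  measureReal_mono (fun ω hω ↦ (hle ω).trans hω)

/-- The section of `{(s, ω) | X₂ ω ≤ e^{-s} < X₁ ω}` at `ω` is the interval
`(-log X₁ ω, -log X₂ ω]`. [folklore] -/
theorem setOf_exp_neg_mem_eq {Ω : Type*} {X₁ X₂ : Ω → ℝ} (hpos : ∀ ω, 0 < X₂ ω)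
    (hle : ∀ ω, X₂ ω ≤ X₁ ω) (ω : Ω) :
    {s : ℝ | X₂ ω ≤ Real.exp (-s) ∧ Real.exp (-s) < X₁ ω} =
      Ioc (-Real.log (X₁ ω)) (-Real.log (X₂ ω)) := by
  have h2 := hpos ω
  have h1 : 0 < X₁ ω := h2.trans_le (hle ω)
  ext s
  simp only [mem_setOf_eq, mem_Ioc]
  rw [← Real.log_le_iff_le_exp h2, ← Real.lt_log_iff_exp_lt h1]
  constructor
  · rintro ⟨ha, hb⟩; exact ⟨by linarith, by linarith⟩
  · rintro ⟨ha, hb⟩; exact ⟨by linarith, by linarith⟩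

/-- **The last display of LSW's Lemma 2.3, for two random variables.** For random variables
`0 < X₂ ≤ X₁` with `uᵢ(s) = P[Xᵢ ≤ e^{-s}]`, and every `a`,
`∫_a^{a+1} (u₂(s) - u₁(s)) ds ≤ E[min{log X₁ - log X₂, 1}]`: by Fubini the left side is
`E[Leb([a, a+1] ∩ (-log X₁, -log X₂])]`. [cite: LawlerSchrammWernerEJP2002, proof of Lemma 2.3 (p. 7)] -/
theorem intervalIntegral_measureReal_sub_le (hX₁ : Measurable X₁) (hX₂ : Measurable X₂)
    (hpos : ∀ ω, 0 < X₂ ω) (hle : ∀ ω, X₂ ω ≤ X₁ ω) (a : ℝ) :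
    ∫ s in a..a + 1, (P.real {ω | X₂ ω ≤ Real.exp (-s)} - P.real {ω | X₁ ω ≤ Real.exp (-s)}) ≤
      ∫ ω, min (Real.log (X₁ ω) - Real.log (X₂ ω)) 1 ∂P := by
  -- the set `E = {(s, ω) | X₂ ω ≤ e^{-s} < X₁ ω}` and its indicator
  set E : Set (ℝ × Ω) := {p | X₂ p.2 ≤ Real.exp (-p.1) ∧ Real.exp (-p.1) < X₁ p.2} with hE
  have hmexp : Measurable fun p : ℝ × Ω ↦ Real.exp (-p.1) :=
    Real.measurable_exp.comp measurable_fst.neg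
  have hEm : MeasurableSet E :=
    (measurableSet_le (hX₂.comp measurable_snd) hmexp).inter
      (measurableSet_lt hmexp (hX₁.comp measurable_snd))
  set F : ℝ → Ω → ℝ := fun s ω ↦ E.indicator 1 (s, ω) with hF
  -- the integrand is `ω`-integral of the indicator
  have hsec : ∀ s, {ω | X₂ ω ≤ Real.exp (-s) ∧ Real.exp (-s) < X₁ ω} = Prod.mk s ⁻¹' E := by
    intro s; ext ω; simp [hE]
  have hinner : ∀ s, P.real {ω | X₂ ω ≤ Real.exp (-s)} - P.real {ω | X₁ ω ≤ Real.exp (-s)} =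
      ∫ ω, F s ω ∂P := by
    intro s
    rw [measureReal_le_exp_neg_sub_eq P hX₁ hle s, hsec s,
      ← integral_indicator_one (hEm.preimage (by fun_prop))]
    rfl
  simp_rw [hinner]
  rw [intervalIntegral.integral_of_le (by linarith : a ≤ a + 1)]
  -- Fubini
  set μ : Measure ℝ := volume.restrict (Ioc a (a + 1)) with hμ
  haveI : IsFiniteMeasure μ := by
    rw [hμ]; exact isFiniteMeasure_restrict.2 (by simp)
  have hint : Integrable (Function.uncurry F) (μ.prod P) := by
    have : Function.uncurry F = E.indicator 1 := by
      funext p; rfl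
    rw [this]
    exact (integrable_const (1 : ℝ)).indicator hEm
  rw [integral_integral_swap hint]
  -- pointwise bound of the inner `s`-integral
  have hptw : ∀ ω, ∫ s, F s ω ∂μ ≤ min (Real.log (X₁ ω) - Real.log (X₂ ω)) 1 := by
    intro ω
    have hsec' : (fun s ↦ F s ω) = (Ioc (-Real.log (X₁ ω)) (-Real.log (X₂ ω))).indicator 1 := by
      funext s
      rw [← setOf_exp_neg_mem_eq hpos hle ω]
      simp only [hF, indicator, mem_setOf_eq, hE, Pi.one_apply]
    rw [hsec', integral_indicator_one measurableSet_Ioc, hμ, measureReal_restrict_apply measurableSet_Ioc]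
    refine le_min ?_ ?_
    · calc volume.real (Ioc (-Real.log (X₁ ω)) (-Real.log (X₂ ω)) ∩ Ioc a (a + 1))
          ≤ volume.real (Ioc (-Real.log (X₁ ω)) (-Real.log (X₂ ω))) :=
            measureReal_mono inter_subset_left (by rw [Real.volume_Ioc]; exact ENNReal.ofReal_ne_top)
        _ = Real.log (X₁ ω) - Real.log (X₂ ω) := by
            rw [Real.volume_real_Ioc, max_eq_left]
            · ring
            · have := Real.log_le_log (hpos ω) (hle ω); linarith
    · calc volume.real (Ioc (-Real.log (X₁ ω)) (-Real.log (X₂ ω)) ∩ Ioc a (a + 1))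
          ≤ volume.real (Ioc a (a + 1)) :=
            measureReal_mono inter_subset_right (by rw [Real.volume_Ioc]; exact ENNReal.ofReal_ne_top)
        _ = 1 := by rw [Real.volume_real_Ioc]; simp
  refine integral_mono hint.integral_prod_right ?_ hptw
  -- integrability of the bound: measurable with values in `[0, 1]`
  have hm : Measurable fun ω ↦ min (Real.log (X₁ ω) - Real.log (X₂ ω)) 1 :=
    ((Real.measurable_log.comp hX₁).sub (Real.measurable_log.comp hX₂)).min measurable_const
  refine Integrable.of_bound hm.aestronglyMeasurable 1 (Eventually.of_forall fun ω ↦ ?_)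
  have h0 : 0 ≤ Real.log (X₁ ω) - Real.log (X₂ ω) := by
    have := Real.log_le_log (hpos ω) (hle ω); linarith
  rw [Real.norm_eq_abs, abs_of_nonneg (le_min h0 zero_le_one)]
  exact min_le_right _ _

/-- **LSW's `h̃(2π, t) - h̃(θ, t) ≤ E[min{log 𝔯(θ) - log 𝔯(2π), 1}]`**, for two random variables
`0 < X₂ ≤ X₁`, `uᵢ(s) = P[Xᵢ ≤ e^{-s}]`, `avg u (t) = ∫_t^{t+1} u`:
`0 ≤ avg u₂ (t) - avg u₁ (t) ≤ E[min{log X₁ - log X₂, 1}]`. [cite: LawlerSchrammWernerEJP2002, proof of Lemma 2.3 (p. 7)] -/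
theorem tildeAvg_sub_tildeAvg_le (hX₁ : Measurable X₁) (hX₂ : Measurable X₂)
    (hpos : ∀ ω, 0 < X₂ ω) (hle : ∀ ω, X₂ ω ≤ X₁ ω) (t : ℝ) :
    0 ≤ tildeAvg (fun s ↦ P.real {ω | X₂ ω ≤ Real.exp (-s)}) t -
        tildeAvg (fun s ↦ P.real {ω | X₁ ω ≤ Real.exp (-s)}) t ∧
      tildeAvg (fun s ↦ P.real {ω | X₂ ω ≤ Real.exp (-s)}) t -
        tildeAvg (fun s ↦ P.real {ω | X₁ ω ≤ Real.exp (-s)}) t ≤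
      ∫ ω, min (Real.log (X₁ ω) - Real.log (X₂ ω)) 1 ∂P := by
  -- the distribution functions are antitone, hence interval integrable
  have hanti : ∀ {X : Ω → ℝ}, Antitone fun s ↦ P.real {ω | X ω ≤ Real.exp (-s)} := by
    intro X a b hab
    exact measureReal_mono fun ω (hω : X ω ≤ Real.exp (-b)) ↦ hω.trans (Real.exp_le_exp.2 (by linarith))
  have hi₁ : IntervalIntegrable (fun s ↦ P.real {ω | X₁ ω ≤ Real.exp (-s)}) volume t (t + 1) :=
    hanti.intervalIntegrable
  have hi₂ : IntervalIntegrable (fun s ↦ P.real {ω | X₂ ω ≤ Real.exp (-s)}) volume t (t + 1) :=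
    hanti.intervalIntegrable
  rw [tildeAvg_eq_integral, tildeAvg_eq_integral, ← intervalIntegral.integral_sub hi₂ hi₁]
  refine ⟨?_, intervalIntegral_measureReal_sub_le P hX₁ hX₂ hpos hle t⟩
  refine intervalIntegral.integral_nonneg (by linarith) fun s _ ↦ ?_
  linarith [measureReal_le_exp_neg_mono P hle s]

/-- **The same for the twice-averaged data `dataU = avg ∘ avg`** of the renewal line:
`0 ≤ dataU u₂ t - dataU u₁ t ≤ E[min{log X₁ - log X₂, 1}]`. [cite: LawlerSchrammWernerEJP2002, proof of Lemma 2.3 (p. 7)] -/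
theorem dataU_sub_dataU_le (hX₁ : Measurable X₁) (hX₂ : Measurable X₂)
    (hpos : ∀ ω, 0 < X₂ ω) (hle : ∀ ω, X₂ ω ≤ X₁ ω) (t : ℝ) :
    0 ≤ dataU (fun s ↦ P.real {ω | X₂ ω ≤ Real.exp (-s)}) t -
        dataU (fun s ↦ P.real {ω | X₁ ω ≤ Real.exp (-s)}) t ∧
      dataU (fun s ↦ P.real {ω | X₂ ω ≤ Real.exp (-s)}) t -
        dataU (fun s ↦ P.real {ω | X₁ ω ≤ Real.exp (-s)}) t ≤
      ∫ ω, min (Real.log (X₁ ω) - Real.log (X₂ ω)) 1 ∂P := by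
  have hanti : ∀ {X : Ω → ℝ}, Antitone fun s ↦ P.real {ω | X ω ≤ Real.exp (-s)} := by
    intro X a b hab
    exact measureReal_mono fun ω (hω : X ω ≤ Real.exp (-b)) ↦ hω.trans (Real.exp_le_exp.2 (by linarith))
  set v₁ := tildeAvg fun s ↦ P.real {ω | X₁ ω ≤ Real.exp (-s)} with hv₁
  set v₂ := tildeAvg fun s ↦ P.real {ω | X₂ ω ≤ Real.exp (-s)} with hv₂
  have ha₁ : Antitone v₁ := tildeAvg_antitone hanti
  have ha₂ : Antitone v₂ := tildeAvg_antitone hanti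
  have hi₁ : IntervalIntegrable v₁ volume t (t + 1) := ha₁.intervalIntegrable
  have hi₂ : IntervalIntegrable v₂ volume t (t + 1) := ha₂.intervalIntegrable
  have hptw : ∀ s, 0 ≤ v₂ s - v₁ s ∧ v₂ s - v₁ s ≤ ∫ ω, min (Real.log (X₁ ω) - Real.log (X₂ ω)) 1 ∂P :=
    fun s ↦ tildeAvg_sub_tildeAvg_le P hX₁ hX₂ hpos hle s
  show 0 ≤ tildeAvg v₂ t - tildeAvg v₁ t ∧ tildeAvg v₂ t - tildeAvg v₁ t ≤ _
  rw [tildeAvg_eq_integral, tildeAvg_eq_integral, ← intervalIntegral.integral_sub hi₂ hi₁]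
  constructor
  · exact intervalIntegral.integral_nonneg (by linarith) fun s _ ↦ (hptw s).1
  · calc ∫ s in t..t + 1, (v₂ s - v₁ s)
        ≤ ∫ s in t..t + 1, (∫ ω, min (Real.log (X₁ ω) - Real.log (X₂ ω)) 1 ∂P) :=
          intervalIntegral.integral_mono_on (by linarith) (hi₂.sub hi₁) intervalIntegrable_const
            fun s _ ↦ (hptw s).2
      _ = ∫ ω, min (Real.log (X₁ ω) - Real.log (X₂ ω)) 1 ∂P := by
          rw [intervalIntegral.integral_const]; simp

end Bridge

end Literature.Probability.Percolation
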